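import Summits.Ventures.Crystal3D.Theorems.StickyWulffConstantCoaxialWallLawHalfUnion
import Summits.Ventures.Crystal3D.Theorems.StickyWulffConstantGenericWallFloorAffineSampleDeficit
import Summits.Ventures.Crystal3D.Theses.StickyWulffConstant
import Summits.Ventures.Crystal3D.StickySpheres.FinsetBridge
import HarnessLib

/-!
# The crux `CoaxialWallLaw` BY NAME from the two stub propositions of line `WallLedgerF`, and modulo the census facts

HONEST FRAMING. Venture `Summits/Ventures/Crystal3D` (cell `crystal3d-full`), helper for the crux
`CoaxialWallLaw` (stmt-Ventures-19481) of `route-Ventures-StickyWulffConstant`, REGISTERED line `WallLedgerF`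
(skeleton `HOME/cf-p1/route/lines/wall/WallLedgerF.lean`, stubs `stub_affineSampleDeficit : AffineSampleDeficit`,
`stub_coaxialTwoSlabAdhesion : CoaxialTwoSlabAdhesion` of `…WallLedgerFDefs`).  Rung credit only; F-C1 not moved;
the crux item is NOT closed here (CONDITIONAL result).

* `coaxialWallLaw_of_stubProps : AffineSampleDeficit → CoaxialTwoSlabAdhesion → CoaxialWallLaw` — the planner's
  kernel-checked skeleton composition `CoaxialWallLaw_holds_of_stubs`, with the two stubs as HYPOTHESES instead of
  sorries (turnkey: the day both propositions are theorems of the tree, this one line closes the crux BY NAME).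
* the S/M stub of line F, `AffineSampleDeficit`, IS the landed `Theorems.stub_affineSampleDeficit` of line `WallLedgerG`
  (the two definitions have the same body; the gate's dedup refuses a by-name copy).
* **`coaxialWallLaw_of_census : … → CoaxialWallLaw`** — THE CRUX'S STATEMENT BY NAME, modulo, BY NAME: `KissingGap δ`
  (`δ > 0`, `δ² > 16/3`), the E1 census rows C12-55 (`hcert`) and A12 glide star (`hcertA`), and the k-fold-top
  census `KFoldTopDeficit` — via `coaxialTwoSlabAdhesion_of_census` (`…HalfUnion`: twins 19481-p1 g6, translations
  19481-p2 g3).  What separates the crux from closure is exactly this finite list of certified-computation targets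
  (and the kissing gap GAP(5/4) of the cell), nothing else.

WHAT THIS IS NOT: an unconditional proof of the crux; F-C1 not moved.
-/

noncomputable section

namespace Summit.Ventures.Crystal3D.Theorems

open Summit.Ventures.Crystal3D Finset Real
open Summit.Ventures.Crystal3D.Cruxes.CoaxialWallLaw.WallLedgerF (AffineSampleDeficit CoaxialTwoSlabAdhesion)
open Literature.MathematicalPhysics.StatisticalMechanics (fccStacking barlowStacking IsHaggSeq contactDeficiency)
open scoped InnerProductSpace

/-- **The skeleton composition with the stubs as hypotheses** (text of the planner's
`CoaxialWallLaw_holds_of_stubs`): the two stub propositions of line `WallLedgerF` give the crux BY NAME. -/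
theorem coaxialWallLaw_of_stubProps (hS : AffineSampleDeficit) (hT : CoaxialTwoSlabAdhesion) :
    Summit.Ventures.Crystal3D.Theses.StickyWulffConstant.CoaxialWallLaw := by
  classical
  intro A₁ t₁ A₂ t₂ hcoax hne
  obtain ⟨L, s₁, s₂, σ, σ', hσ, hσ', hL₁, hL₂, C, R₀, hR₀, hadh⟩ := hT A₁ t₁ A₂ t₂ hcoax hne
  obtain ⟨C₁, hC₁⟩ := hS A₁ t₁ R₀ hR₀
  obtain ⟨C₂, hC₂⟩ := hS A₂ t₂ R₀ hR₀
  refine ⟨L, s₁, s₂, σ, σ', hσ, hσ', hL₁, hL₂, |C| + |C₁| + |C₂|, R₀, by linarith, ?_⟩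
  intro h hh ρ hρ N x hx hcyl hslab₁ hslab₂
  -- abbreviations
  set φ₁ : ℝ := Real.sqrt 2 / 4 * ∑ᶠ w ∈ {w ∈ fccStacking 1 (Real.sqrt (2 / 3)) | ‖w‖ = 1},
      |⟪w, A₁.symm (EuclideanSpace.single (2 : Fin 3) (1 : ℝ))⟫_ℝ| with hφ₁
  set φ₂ : ℝ := Real.sqrt 2 / 4 * ∑ᶠ w ∈ {w ∈ fccStacking 1 (Real.sqrt (2 / 3)) | ‖w‖ = 1},
      |⟪w, A₂.symm (EuclideanSpace.single (2 : Fin 3) (1 : ℝ))⟫_ℝ| with hφ₂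
  -- the packing as a finite set, the two samples as filters
  have hxinj : Function.Injective x := hx.injective
  set X : Finset (EuclideanSpace ℝ (Fin 3)) := univ.image x with hX
  set P₁ : Finset (EuclideanSpace ℝ (Fin 3)) := X.filter fun p =>
    p ∈ (fun q => A₁ q + t₁) '' fccStacking 1 (Real.sqrt (2 / 3)) ∧
      -(2 * R₀) ≤ p 2 ∧ p 2 ≤ -R₀ ∧ p 0 ^ 2 + p 1 ^ 2 ≤ ρ ^ 2 with hP₁
  set P₂ : Finset (EuclideanSpace ℝ (Fin 3)) := (X \ P₁).filter fun p =>
    p ∈ (fun q => A₂ q + t₂) '' fccStacking 1 (Real.sqrt (2 / 3)) ∧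
      h + R₀ ≤ p 2 ∧ p 2 ≤ h + 2 * R₀ ∧ p 0 ^ 2 + p 1 ^ 2 ≤ ρ ^ 2 with hP₂
  have hXpack : ∀ p ∈ X, ∀ q ∈ X, p ≠ q → 1 ≤ dist p q := by
    intro p hp q hq hpq
    obtain ⟨i, -, rfl⟩ := mem_image.1 hp
    obtain ⟨j, -, rfl⟩ := mem_image.1 hq
    exact hx.one_le_dist fun hij => hpq (by rw [hij])
  have hP₁X : P₁ ⊆ X := filter_subset _ _
  have hP₂X : P₂ ⊆ X \ P₁ := filter_subset _ _
  have hXcyl : ∀ p ∈ X, -(2 * R₀) ≤ p 2 ∧ p 2 ≤ h + 2 * R₀ ∧ p 0 ^ 2 + p 1 ^ 2 ≤ ρ ^ 2 := by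
    intro p hp
    obtain ⟨i, -, rfl⟩ := mem_image.1 hp
    exact hcyl i
  have hP₁iff : ∀ p, p ∈ P₁ ↔ (p ∈ (fun q => A₁ q + t₁) '' fccStacking 1 (Real.sqrt (2 / 3)) ∧
      -(2 * R₀) ≤ p 2 ∧ p 2 ≤ -R₀ ∧ p 0 ^ 2 + p 1 ^ 2 ≤ ρ ^ 2) := by
    intro p
    rw [hP₁, mem_filter]
    refine ⟨fun hp => hp.2, fun hp => ⟨?_, hp⟩⟩
    obtain ⟨i, hi⟩ := hslab₁ p hp.1 ⟨hp.2.1, hp.2.2.1, hp.2.2.2⟩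
    exact mem_image.2 ⟨i, mem_univ _, hi⟩
  have hP₂iff : ∀ p, p ∈ P₂ ↔ (p ∈ (fun q => A₂ q + t₂) '' fccStacking 1 (Real.sqrt (2 / 3)) ∧
      h + R₀ ≤ p 2 ∧ p 2 ≤ h + 2 * R₀ ∧ p 0 ^ 2 + p 1 ^ 2 ≤ ρ ^ 2) := by
    intro p
    rw [hP₂, mem_filter]
    refine ⟨fun hp => hp.2, fun hp => ⟨?_, hp⟩⟩
    obtain ⟨i, hi⟩ := hslab₂ p hp.1 ⟨hp.2.1, hp.2.2.1, hp.2.2.2⟩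
    rw [mem_sdiff]
    refine ⟨mem_image.2 ⟨i, mem_univ _, hi⟩, fun hp1 => ?_⟩
    have h1 := ((hP₁iff p).1 hp1).2.2.1
    have h2 := hp.2.1
    linarith
  -- the three inequalities and the two splits
  have hadh' := hadh h hh ρ hρ X P₁ P₂ hXpack hP₁X hP₂X hXcyl hP₁iff hP₂iff
  have hD₁ := hC₁ (-(2 * R₀)) (-R₀) (by ring) ρ hρ P₁ hP₁iff
  have hD₂ := hC₂ (h + R₀) (h + 2 * R₀) (by ring) ρ hρ P₂ hP₂iff
  have hsplit₁ := contactDeficiency_sdiff_split hP₁X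
  have hsplit₂ := contactDeficiency_sdiff_split hP₂X
  have hDX : contactDeficiency X = 6 * (N : ℝ) - (numContacts x : ℝ) :=
    contactDeficiency_image_eq x hxinj
  rw [← hDX]
  have hρ0 : (0 : ℝ) ≤ ρ := by linarith
  have ha : C * (1 + h) * ρ ≤ |C| * (1 + h) * ρ := by
    have h1 : 0 ≤ (|C| - C) * ((1 + h) * ρ) := mul_nonneg (by linarith only [le_abs_self C]) (by positivity)
    linarith only [h1]
  have hb : C₁ * ρ ≤ |C₁| * (1 + h) * ρ := by
    have h1 : 0 ≤ (|C₁| - C₁) * ρ := mul_nonneg (by linarith only [le_abs_self C₁]) hρ0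
    have h2 : 0 ≤ |C₁| * h * ρ := by positivity
    linarith only [h1, h2]
  have hc' : C₂ * ρ ≤ |C₂| * (1 + h) * ρ := by
    have h1 : 0 ≤ (|C₂| - C₂) * ρ := mul_nonneg (by linarith only [le_abs_self C₂]) hρ0
    have h2 : 0 ≤ |C₂| * h * ρ := by positivity
    linarith only [h1, h2]
  linarith only [hadh', hD₁, hD₂, hsplit₁, hsplit₂, ha, hb, hc']

/-- **THE CRUX `CoaxialWallLaw` BY NAME, MODULO THE NAMED CENSUS FACTS** (E1 rows C12-55 / A12 glide star, the
k-fold-top census `KFoldTopDeficit`) and the kissing gap `KissingGap δ`, `δ > 0`, `δ² > 16/3`.  See the module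
docstring. -/
theorem coaxialWallLaw_of_census {δ : ℝ} (hg : KissingGap δ) (hδ0 : 0 < δ) (hδ : 16 / 3 < δ ^ 2)
    (hK : KFoldTopDeficit)
    {s₀ : EuclideanSpace ℝ (Fin 3)} (hs₀ : s₀ ∈ fccSlots)
    (hcert : ExactOnly 0 (fccSlots.filter fun w => 0 < ⟪w, s₀⟫_ℝ))
    (hcertA : ∀ (A : EuclideanSpace ℝ (Fin 3) ≃ₗᵢ[ℝ] EuclideanSpace ℝ (Fin 3)) (n : EuclideanSpace ℝ (Fin 3)),
      ‖n‖ = 1 → (∀ w ∈ fccSlots, ⟪A w, n⟫_ℝ = 0 ∨ ⟪A w, n⟫_ℝ = Real.sqrt (2 / 3) ∨ ⟪A w, n⟫_ℝ = -Real.sqrt (2 / 3)) →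
      ∀ u ∈ fccSlots, ⟪A u, n⟫_ℝ = 0 → ∀ b : EuclideanSpace ℝ (Fin 3),
      ExactOnly b (insert (b - A u)
        (((fccSlots.filter fun s => ⟪s, u⟫_ℝ = -(1 / 2) ∧ ⟪A (u + s), n⟫_ℝ ≤ 0).image (fun s => b + A s)) ∪
          ((fccSlots.filter fun s => ⟪s, u⟫_ℝ = -(1 / 2) ∧ ⟪A (u + s), n⟫_ℝ < 0).image
            (fun s => b + (A s - (2 * ⟪A s, n⟫_ℝ) • n)))))) :
    Summit.Ventures.Crystal3D.Theses.StickyWulffConstant.CoaxialWallLaw :=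
  -- line F's S/M stub `AffineSampleDeficit` IS the landed `Theorems.stub_affineSampleDeficit` of line G (same body)
  coaxialWallLaw_of_stubProps Summit.Ventures.Crystal3D.Theorems.stub_affineSampleDeficit
    (coaxialTwoSlabAdhesion_of_census hg hδ0 hδ hK hs₀ hcert hcertA)

end Summit.Ventures.Crystal3D.Theorems

end
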